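import Summits.FinalStateConjecture.FinalStateConjecture.Theses.RecedingSphereBudgets
import Literature.Geometry.Lorentzian.TameGenericityDiagonal
import Literature.Geometry.Lorentzian.TameGenericityLocal

/-!
# Crux `ShapeSettledFinalEra` — line `birth`: BIRTH SKELETON (BC3; skeleton registrar, 2026-08-17)

Crux item `stmt-FinalStateConjecture-17685`, decl (FIXED, concluded BY NAME in
`ShapeSettledFinalEra_of` / `ShapeSettledFinalEra_proof`):
`Summit.FinalStateConjecture.FinalStateConjecture.Theses.RecedingSphereBudgets.ShapeSettledFinalEra`
(route `route-FinalStateConjecture-RecedingSphereBudgets`, crux rank 3, the route's IMPORTED HALF / large-data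
front end H): for every connected Hausdorff second-countable 3-manifold `X`, TAME-Christodoulou-generically in
`admissibleVacuumData X` an MGHD exists, and every MGHD has complete `𝓘⁺` and admits a SHAPE-SETTLED FINAL ERA
WITH DRIFTING LABELS `Q′` (collar hole charts on `{r > r₊(M(t*),a(t*)) − δ₀}` of boosted Kerr–Schild
coordinates with fixed hyperbolic motions, `C^k` shape convergence for EVERY `k` to the adiabatic background with
smooth boxed sub-extremal labels, flat late chart `C² → η` with sublinear excision, wave-zone weights, finite slab
energy, separation, localisation, covering, rays, orientation, growing-radii exhaustiveness).

## The cut (three named stubs; the route header's own TWO-LAYER PLAN for H — "(generic capture / ω-limit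
## statement) → … → ShapeSettledFinalEra" — typed over existing declarations only)

Tame Christodoulou genericity `IsTameChristodoulouGeneric 𝓓 P 1` is MONOTONE under pointwise implication
(`InitialDataSet.IsTameChristodoulouGeneric.mono`, landed) but NOT closed under conjunction; a generic HYPOTHESIS
enters the proof of a generic CONCLUSION only ALONG ITS WITNESS CURVES
(`InitialDataSet.isTameChristodoulouGeneric_of_relative'`, TameGenericityDiagonal.lean, landed). Hence:

* `stub_tameCensorship` — TAME WEAK COSMIC CENSORSHIP + MGHD EXISTENCE: tame-generically in the admissible class an
  MGHD exists and every MGHD has complete `𝓘⁺`. Byte-for-byte the open sibling item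
  `PhaseMixingCapture.WeakCosmicCensorshipTame` (stmt-FinalStateConjecture-17269; one statement, shared work), and a
  CONSEQUENCE of the summit (`tameCensorship_of_finalStateConjecture`, landed) — used here toward the crux as the
  generic hypothesis `Q` of the relative composition. [open-problem; XL]
* `stub_captureAlongCensoredCurves` — LARGE-DATA KERR-FAMILY CAPTURE, RELATIVE TO CENSORSHIP, IN THE STATEMENT'S
  `C²` CURRENCY: along every tame curve of admissible data (immersed-and-injective, or constant) whose members off
  `0` are censored there is a tame, immersed, injective admissible curve through the SAME base datum whose SMALL
  members off `0` are censored and whose MGHDs admit a `C²`-SHAPE-SETTLED ERA WITH DRIFTING LABELS `P₀` = `Q′`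
  with near-zone convergence in `C²` only (clause `∀ i R, truncDeviationCk … 2 R τ → 0` instead of `∀ k`) and
  WITHOUT the wave-zone weight and slab-energy clauses; everything else of `Q′` (collar, labels, hyperbolic
  pairwise-distinct motions, separation, excision, `O`, rays, orientation, covering, localisation, exhaustiveness)
  verbatim. The constant branch says the THRESHOLD strata inside censored data (exactly-extremal remnants,
  parabolic final motions, eternal non-Kerr dynamics) have positive tame codimension; the curve branch says capture
  can be arranged near a censorship-violating datum along its censoring escape. Pointwise "censored ⇒ settles" is
  FALSE on thresholds (Kehle–Unger), which is why the statement is relative. [open-problem; XL]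
* `stub_regularityDecayUpgrade` — REGULARITY AND FAR-FIELD DECAY UPGRADE, UNIVERSAL (no genericity): for EVERY
  admissible datum and EVERY MGHD with complete `𝓘⁺`, a `P₀`-era can be re-witnessed as a `Q′`-era: `C² ⇒ C^k`
  for every `k` on the truncated collar slabs (re-chosen charts/labels; vacuum propagation of regularity, red-shift
  on the collar, no frequency cascade in a settling exterior) and a re-gauged flat chart with
  `(1+d)^{9/10}|h|, (1+d)|D^{1,2}h| ≤ C_W` and `∫|Dh|² ≤ C_E` on late slabs (far-field `1/d` asymptotics with log
  losses, finite total radiated energy). These are exactly H's self-imposed extras over the Statement's currency —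
  the crux's own "why it might fail" (all-`k` collar closeness, log-tail-fragile weights) isolated as one refutable
  classical-analysis target. [L]

Composition `ShapeSettledFinalEra_of` (kernel-checked, no `sorry` of its own): sole strongly-AF ends of admissible
data (`exists_isSoleEnd_of_mem_admissibleVacuumData`) make constant curves tame; `relative'` with `Q = censored`,
`P = P₀-settled`, the relative witnesses being Stub 2 globalised in the parameter by the landed radial
reparametrisation `exists_tameCurve_of_local`; then `.mono` with Stub 3 pointwise (MGHD by MGHD) yields the crux
verbatim. Neither stub alone is the crux: Stub 1 has no settling, Stub 2 produces nothing without censoring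
curves, Stub 3 is conditional on a `P₀`-era.

## BC3 probes (seat folder `bc/ShapeSettledFinalEra_probes*.lean`; they import the ROUTE FILE ONLY — not this
## skeleton — so no sorried theorem concluding the crux is in scope for `exact?`): see `Lines/birth.md`.

## Disproof used
None relevant: the crux has no `Disproof.lean` / Negative lemmas (`ledger crux ls stmt-FinalStateConjecture-17685`:
no workfiles before this one); `ledger negatives --problem FinalStateConjecture` lists one unrelated refutation
(`not_UniformPhotonSphereChannels`). No stub is an instance of it.
-/

noncomputable section

-- the doubled `FinalStateConjecture.FinalStateConjecture` path component trips dupNamespace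
set_option linter.dupNamespace false

namespace Summit.FinalStateConjecture.FinalStateConjecture.Cruxes.ShapeSettledFinalEra.Birth

open scoped BigOperators Topology Manifold Classical MeasureTheory ProbabilityTheory Matrix InnerProductSpace ComplexConjugate ContinuousMap ContDiff ENNReal
open Filter Set Function TopologicalSpace MeasureTheory
open Literature.Geometry.Lorentzian Summit.FinalStateConjecture
open Summit.FinalStateConjecture.FinalStateConjecture.Theses.RecedingSphereBudgets

/-! ## §1 The three statements of the line (named; nothing here is a route item) -/

/-- **TAME WEAK COSMIC CENSORSHIP WITH MGHD EXISTENCE** (`stub_tameCensorship`): for every connected Hausdorff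
second-countable smooth `3`-manifold `X`, tame-Christodoulou-generically in `admissibleVacuumData X`
(`IsTameChristodoulouGeneric … 1`: through every exceptional admissible datum passes an injective one-parameter
family of admissible data, tame on one fixed asymptotically flat end and immersed at `0`, all of whose other
members are good) a maximal vacuum Cauchy development exists and EVERY maximal development has complete future
null infinity (sojourn form). Christodoulou's formulation of weak cosmic censorship (exceptional set of positive
codimension in a fixed space of data with fixed asymptotics), a theorem for the spherically symmetric scalar field,
OPEN in vacuum without symmetry; the statement is byte-identical to the sibling item
`PhaseMixingCapture.WeakCosmicCensorshipTame` (stmt-FinalStateConjecture-17269) and is implied by the summit.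
Why it might fail: vacuum naked singularities (Rodnianski–Shlapentokh-Rothman) might be stable under admissible
perturbations at FIXED asymptotics; tameness forbids censoring by burial under a far-out giant hole.
[cite: Christodoulou1999, p. A24] [cite: arXiv08110354, §2.6.2] -/
def TameCensorship : Prop :=
  ∀ (X : Type) [TopologicalSpace X] [ChartedSpace E3 X] [IsManifold (𝓡 3) (⊤ : ℕ∞) X] [T2Space X] [SecondCountableTopology X] [ConnectedSpace X], InitialDataSet.IsTameChristodoulouGeneric (admissibleVacuumData X) (fun D ↦ (∃ 𝒟 : VacuumCauchyDevelopment D, 𝒟.IsMaximal) ∧ ∀ 𝒟 : VacuumCauchyDevelopment D, 𝒟.IsMaximal → HasCompleteNullInfinity 𝒟.toCauchyDevelopment) 1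

/-- **LARGE-DATA KERR-FAMILY CAPTURE ALONG CENSORED CURVES, `C²` CURRENCY** (`stub_captureAlongCensoredCurves`):
for every end `e` and every tame (on `e`) curve `F` of admissible vacuum data which is either immersed at `0` and
injective or constant, and whose members off `0` are CENSORED (an MGHD exists; every MGHD has complete `𝓘⁺`),
there are an end `e'`, a tame, immersed, injective curve `F'` of admissible data with `F' 0 = F 0`, and `ε > 0`
such that for `0 < ‖c‖ < ε` the datum `F' c` is censored and every MGHD of it admits a `C²`-SHAPE-SETTLED FINAL
ERA WITH DRIFTING LABELS `P₀`: `N` collar hole charts on `{r > r₊(M(t*),a(t*)) − δ₀}` of boosted Kerr–Schild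
coordinates with fixed orthochronous pairwise-distinct motions, smooth boxed sub-extremal labels with all
derivatives `→ 0`, `C²` convergence to the adiabatic background on every truncated slab, separation, sublinear
excision, a flat late chart `C² → η` into `O = exteriorOf(flat late image ∪ exterior parts)`, rays in the closure,
future orientation, covering, chart localisation and growing-radii exhaustiveness — the block of the crux with
`C²` in place of `C^k ∀ k` and without the wave-zone weight and slab-energy clauses. The `hrel` shape of
`InitialDataSet.isTameChristodoulouGeneric_of_relative'` with `Q = censored`, local in the parameter. Why it
might fail: beyond finite-`N` Kerr-family capture for large censored data (open) it asserts generic HYPERBOLIC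
pairwise-distinct final motions and codimension ≥ 1 of every threshold stratum (exactly-extremal formation,
parabolic escape, eternal non-Kerr dynamics) ALONG tame curves at fixed asymptotics; a censoring curve tangent to
a threshold hypersurface at `c_n → 0` with no transversal admissible direction on the same data would break it.
[cite: DafermosLuk2017, Conjecture 1] [cite: Christodoulou1999, p. A24] -/
def CaptureAlongCensoredCurves : Prop :=
  ∀ (X : Type) [TopologicalSpace X] [ChartedSpace E3 X] [IsManifold (𝓡 3) (⊤ : ℕ∞) X] [T2Space X] [SecondCountableTopology X] [ConnectedSpace X], ∀ (e : AFEnd X) (F : EuclideanSpace ℝ (Fin 1) → InitialDataSet (𝓡 3) X), InitialDataSet.IsTameDataFamily e 1 F → ((InitialDataSet.IsImmersedAtZero 1 F ∧ Function.Injective F) ∨ ∀ c, F c = F 0) → (∀ c, F c ∈ admissibleVacuumData X) → (∀ c ≠ 0, (∃ 𝒟 : VacuumCauchyDevelopment (F c), 𝒟.IsMaximal) ∧ ∀ 𝒟 : VacuumCauchyDevelopment (F c), 𝒟.IsMaximal → HasCompleteNullInfinity 𝒟.toCauchyDevelopment) → ∃ (e' : AFEnd X) (F' : EuclideanSpace ℝ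 (Fin 1) → InitialDataSet (𝓡 3) X), InitialDataSet.IsTameDataFamily e' 1 F' ∧ InitialDataSet.IsImmersedAtZero 1 F' ∧ F' 0 = F 0 ∧ Function.Injective F' ∧ (∀ c, F' c ∈ admissibleVacuumData X) ∧ ∃ ε > (0 : ℝ), ∀ c, c ≠ 0 → ‖c‖ < ε → ((∃ 𝒟 : VacuumCauchyDevelopment (F' c), 𝒟.IsMaximal) ∧ ∀ 𝒟 : VacuumCauchyDevelopment (F' c), 𝒟.IsMaximal → HasCompleteNullInfinity 𝒟.toCauchyDevelopment ∧ ∃ (N : ℕ) (m₀ χ τ₀ δ₀ : ℝ) (M a : Fin N → ℝ → ℝ) (motion : Fin N → lorentzGroup × E4) (U : Fin N → Opens E4) (Ψ : ∀ i, U i → 𝒟.carrier) (ρ : Fin N → ℝ → ℝ) (U₀ : Opens E4) (Ψ₀ : U₀ → 𝒟.carrier) (O : Set 𝒟.carrier), (let S := 𝒟.toSpacetime; let 𝒞 := 𝒟.toCauchyDevelopment; let J := 𝒟.metric.causalPast 𝒟.timeOrientation; let L := fun i ↦ ((motion i).1 : E4 ≃L[ℝ] E4); let p := fun i ↦ poincareInv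 (motion i).1 (motion i).2; let e := fun i ↦ L i (E4.basisVector 0); let B : Fin N → ModelBackground := fun i ↦ ⟨U i, fun x ↦ boostedKerrBilin (motion i).1 (motion i).2 (M i (p i x 0)) (a i (p i x 0)) x, fun x ↦ p i x 0, fun x ↦ Kerr.radius (a i (p i x 0)) (p i x)⟩; let ξ := fun i (t : ℝ) ↦ E4.spatial (((t - (motion i).2 0) / e i 0) • e i + (motion i).2); let B₀ := Minkowski.backgroundOn U₀; let ext := fun i ↦ (B i).lateRegion τ₀ ∩ {x | Kerr.rPlus (M i (p i x.1 0)) (a i (p i x.1 0)) < (B i).radius x.1}; (0 < m₀ ∧ 0 ≤ χ ∧ χ < 1 ∧ 0 < δ₀ ∧ 2 * δ₀ < m₀) ∧ (∀ i, ContDiff ℝ (⊤ : ℕ∞) (M i) ∧ ContDiff ℝ (⊤ : ℕ∞) (a i) ∧ (∀ t, m₀ ≤ M i t ∧ M i t ≤ m₀⁻¹ ∧ |a i t| ≤ χ * M i t) ∧ ∀ n : ℕ, 1 ≤ n → Tendsto (iteratedDeriv n (M i)) atTop (𝓝 0) ∧ Tendsto (iteratedDeriv n (a i)) atTop (𝓝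 0)) ∧ (∀ i, 0 < e i 0) ∧ Function.Injective e ∧ (∀ i, (U i : Set E4) = p i ⁻¹' {y : E4 | Kerr.rPlus (M i (y 0)) (a i (y 0)) - δ₀ < Kerr.radius (a i (y 0)) y}) ∧ (∀ i, S.IsLateChart (B i) Set.univ τ₀ (Ψ i) ∧ Ψ i '' ext i ⊆ O) ∧ (∀ i (R : ℝ), Tendsto (S.truncDeviationCk (B i) (Ψ i) 2 R) atTop (𝓝 0)) ∧ (∀ R : ℝ, ∃ τ₁, Pairwise (Disjoint on fun i ↦ Ψ i '' (B i).truncLateRegion τ₁ R)) ∧ (∀ i, Tendsto (fun t ↦ ρ i t / t) atTop (𝓝 0)) ∧ {x : E4 | τ₀ < x 0 ∧ ∀ i, ρ i (x 0) < E4.spatialNorm (p i x)} ⊆ ↑U₀ ∧ S.IsLateChart B₀ O τ₀ Ψ₀ ∧ Tendsto (S.deviationCk B₀ Ψ₀ 2) atTop (𝓝 0) ∧ O = exteriorOf 𝒞 (Ψ₀ '' B₀.lateRegion τ₀ ∪ ⋃ i, Ψ i '' ext i) ∧ (∀ τ₁ ≥ τ₀, RaysStayInClosure 𝒞 (exteriorOf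 𝒞 (Ψ₀ '' B₀.lateRegion τ₁))) ∧ (∀ i (ϱ : ℝ), ∀ᶠ τ in atTop, ∀ x ∈ (B i).truncTimeSlab ϱ τ, 𝒟.timeOrientation.IsFutureDirected (mfderiv 𝓘(ℝ, E4) (𝓡 4) (Ψ i) x (L i (Kerr.timeVector (M i (p i x.1 0)) (a i (p i x.1 0)) (p i x.1))))) ∧ (∀ᶠ τ in atTop, ∀ x ∈ B₀.timeSlab τ, 𝒟.timeOrientation.IsFutureDirected (mfderiv 𝓘(ℝ, E4) (𝓡 4) Ψ₀ x (E4.basisVector 0))) ∧ O \ ((⋃ i, Ψ i '' (B i).lateRegion τ₀) ∪ Ψ₀ '' B₀.lateRegion τ₀) ⊆ J ((⋃ i, Ψ i '' (B i).timeSlab τ₀) ∪ Ψ₀ '' B₀.timeSlab τ₀) ∧ (∃ C₁ C₂ : ℝ, ∀ i (x : U i) (y : U₀), τ₀ < (B i).time x.1 → Ψ i x = Ψ₀ y → ‖E4.spatial y.1 - ξ i (y.1 0)‖ ≤ C₂ * (B i).radius x.1 + C₁) ∧ ∃ R : Fin N → ℝ → ℝ, (∀ i, Tendsto (fun τ ↦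 S.truncDeviationCk (B i) (Ψ i) 2 (R i τ) τ) atTop (𝓝 0)) ∧ ∀ τ₁ > τ₀, O \ (Ψ₀ '' B₀.lateRegion τ₁ ∪ ⋃ i, Ψ i '' {x | τ₁ < (B i).time x.1 ∧ (B i).radius x.1 ≤ R i ((B i).time x.1)}) ⊆ J (Ψ₀ '' B₀.timeSlab τ₁ ∪ ⋃ i, Ψ i '' (B i).truncTimeSlab (R i τ₁) τ₁)))

/-- **REGULARITY AND FAR-FIELD DECAY UPGRADE, UNIVERSAL** (`stub_regularityDecayUpgrade`): for every admissible
vacuum datum, every maximal vacuum Cauchy development with complete `𝓘⁺` that admits a `C²`-shape-settled final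
era with drifting labels `P₀` admits a shape-settled final era with drifting labels `Q′` in the crux's sense:
near-zone convergence in `C^k` for EVERY `k` on the truncated collar slabs (charts and labels re-chosen), and a
flat late chart carrying the wave-zone weights `(1+d)^{9/10}|h| ≤ C_W`, `(1+d)|D^m h| ≤ C_W` (`m = 1, 2`) and the
slab energy bound `∫|Dh|² ≤ C_E` eventually. No genericity: propagation of regularity for the vacuum equations in
a settling exterior-plus-collar (red-shift at a sub-extremal horizon with `κ` bounded below on the compact label
box; no frequency cascade), and far-field `1/d` asymptotics with logarithmic losses plus finite total radiated
energy in a re-gauged flat chart. Why it might fail: `C²` smallness on compact slabs gives no uniform control of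
third derivatives (small-amplitude high-frequency content at arbitrarily late times is not excluded by any clause
of `P₀`), and the `(1+d)^{9/10}` sup-weight uniform in `τ` needs bounded news over the WHOLE history including the
large-data era. [cite: arXiv210408222, §1] [cite: DafermosLuk2017, Conjecture 1] -/
def RegularityDecayUpgrade : Prop :=
  ∀ (X : Type) [TopologicalSpace X] [ChartedSpace E3 X] [IsManifold (𝓡 3) (⊤ : ℕ∞) X] [T2Space X] [SecondCountableTopology X] [ConnectedSpace X], ∀ D ∈ admissibleVacuumData X, ∀ 𝒟 : VacuumCauchyDevelopment D, 𝒟.IsMaximal → HasCompleteNullInfinity 𝒟.toCauchyDevelopment → (∃ (N : ℕ) (m₀ χ τ₀ δ₀ : ℝ) (M a : Fin N → ℝ → ℝ) (motion : Fin N → lorentzGroup × E4) (U : Fin N → Opens E4) (Ψ : ∀ i, U i → 𝒟.carrier) (ρ : Fin N → ℝ → ℝ) (U₀ : Opens E4) (Ψ₀ : U₀ → 𝒟.carrier) (O : Set 𝒟.carrier), (let S := 𝒟.toSpacetime; let 𝒞 := 𝒟.toCauchyDevelopment; let J := 𝒟.metric.causalPast 𝒟.timeOrientation; let L := fun i ↦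 ((motion i).1 : E4 ≃L[ℝ] E4); let p := fun i ↦ poincareInv (motion i).1 (motion i).2; let e := fun i ↦ L i (E4.basisVector 0); let B : Fin N → ModelBackground := fun i ↦ ⟨U i, fun x ↦ boostedKerrBilin (motion i).1 (motion i).2 (M i (p i x 0)) (a i (p i x 0)) x, fun x ↦ p i x 0, fun x ↦ Kerr.radius (a i (p i x 0)) (p i x)⟩; let ξ := fun i (t : ℝ) ↦ E4.spatial (((t - (motion i).2 0) / e i 0) • e i + (motion i).2); let B₀ := Minkowski.backgroundOn U₀; let ext := fun i ↦ (B i).lateRegion τ₀ ∩ {x | Kerr.rPlus (M i (p i x.1 0)) (a i (p i x.1 0)) < (B i).radius x.1}; (0 < m₀ ∧ 0 ≤ χ ∧ χ < 1 ∧ 0 < δ₀ ∧ 2 * δ₀ < m₀) ∧ (∀ i, ContDiff ℝ (⊤ : ℕ∞) (M i) ∧ ContDiff ℝ (⊤ : ℕ∞) (a i) ∧ (∀ t, m₀ ≤ M i t ∧ M i t ≤ m₀⁻¹ ∧ |a i t| ≤ χ * M i t) ∧ ∀ n : ℕ, 1 ≤ n → Tendsto (iteratedDeriv n (M i)) atTop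 (𝓝 0) ∧ Tendsto (iteratedDeriv n (a i)) atTop (𝓝 0)) ∧ (∀ i, 0 < e i 0) ∧ Function.Injective e ∧ (∀ i, (U i : Set E4) = p i ⁻¹' {y : E4 | Kerr.rPlus (M i (y 0)) (a i (y 0)) - δ₀ < Kerr.radius (a i (y 0)) y}) ∧ (∀ i, S.IsLateChart (B i) Set.univ τ₀ (Ψ i) ∧ Ψ i '' ext i ⊆ O) ∧ (∀ i (R : ℝ), Tendsto (S.truncDeviationCk (B i) (Ψ i) 2 R) atTop (𝓝 0)) ∧ (∀ R : ℝ, ∃ τ₁, Pairwise (Disjoint on fun i ↦ Ψ i '' (B i).truncLateRegion τ₁ R)) ∧ (∀ i, Tendsto (fun t ↦ ρ i t / t) atTop (𝓝 0)) ∧ {x : E4 | τ₀ < x 0 ∧ ∀ i, ρ i (x 0) < E4.spatialNorm (p i x)} ⊆ ↑U₀ ∧ S.IsLateChart B₀ O τ₀ Ψ₀ ∧ Tendsto (S.deviationCk B₀ Ψ₀ 2) atTop (𝓝 0) ∧ O = exteriorOf 𝒞 (Ψ₀ '' B₀.lateRegion τ₀ ∪ ⋃ i, Ψ i '' ext i)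 ∧ (∀ τ₁ ≥ τ₀, RaysStayInClosure 𝒞 (exteriorOf 𝒞 (Ψ₀ '' B₀.lateRegion τ₁))) ∧ (∀ i (ϱ : ℝ), ∀ᶠ τ in atTop, ∀ x ∈ (B i).truncTimeSlab ϱ τ, 𝒟.timeOrientation.IsFutureDirected (mfderiv 𝓘(ℝ, E4) (𝓡 4) (Ψ i) x (L i (Kerr.timeVector (M i (p i x.1 0)) (a i (p i x.1 0)) (p i x.1))))) ∧ (∀ᶠ τ in atTop, ∀ x ∈ B₀.timeSlab τ, 𝒟.timeOrientation.IsFutureDirected (mfderiv 𝓘(ℝ, E4) (𝓡 4) Ψ₀ x (E4.basisVector 0))) ∧ O \ ((⋃ i, Ψ i '' (B i).lateRegion τ₀) ∪ Ψ₀ '' B₀.lateRegion τ₀) ⊆ J ((⋃ i, Ψ i '' (B i).timeSlab τ₀) ∪ Ψ₀ '' B₀.timeSlab τ₀) ∧ (∃ C₁ C₂ : ℝ, ∀ i (x : U i) (y : U₀), τ₀ < (B i).time x.1 → Ψ i x = Ψ₀ y → ‖E4.spatial y.1 - ξ i (y.1 0)‖ ≤ C₂ * (B i).radius x.1 + C₁)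 ∧ ∃ R : Fin N → ℝ → ℝ, (∀ i, Tendsto (fun τ ↦ S.truncDeviationCk (B i) (Ψ i) 2 (R i τ) τ) atTop (𝓝 0)) ∧ ∀ τ₁ > τ₀, O \ (Ψ₀ '' B₀.lateRegion τ₁ ∪ ⋃ i, Ψ i '' {x | τ₁ < (B i).time x.1 ∧ (B i).radius x.1 ≤ R i ((B i).time x.1)}) ⊆ J (Ψ₀ '' B₀.timeSlab τ₁ ∪ ⋃ i, Ψ i '' (B i).truncTimeSlab (R i τ₁) τ₁))) → ∃ (N : ℕ) (m₀ χ τ₀ δ₀ : ℝ) (M a : Fin N → ℝ → ℝ) (motion : Fin N → lorentzGroup × E4) (U : Fin N → Opens E4) (Ψ : ∀ i, U i → 𝒟.carrier) (ρ : Fin N → ℝ → ℝ) (U₀ : Opens E4) (Ψ₀ : U₀ → 𝒟.carrier) (O : Set 𝒟.carrier), (let S := 𝒟.toSpacetime; let 𝒞 := 𝒟.toCauchyDevelopment; let J := 𝒟.metric.causalPast 𝒟.timeOrientation; let L := fun i ↦ ((motion i).1 : E4 ≃L[ℝ] E4); let p := fun i ↦ poincareInv (motion i).1 (motion i).2; let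 e := fun i ↦ L i (E4.basisVector 0); let B : Fin N → ModelBackground := fun i ↦ ⟨U i, fun x ↦ boostedKerrBilin (motion i).1 (motion i).2 (M i (p i x 0)) (a i (p i x 0)) x, fun x ↦ p i x 0, fun x ↦ Kerr.radius (a i (p i x 0)) (p i x)⟩; let ξ := fun i (t : ℝ) ↦ E4.spatial (((t - (motion i).2 0) / e i 0) • e i + (motion i).2); let B₀ := Minkowski.backgroundOn U₀; let h := S.deviationExtend B₀ Ψ₀; let ext := fun i ↦ (B i).lateRegion τ₀ ∩ {x | Kerr.rPlus (M i (p i x.1 0)) (a i (p i x.1 0)) < (B i).radius x.1}; (0 < m₀ ∧ 0 ≤ χ ∧ χ < 1 ∧ 0 < δ₀ ∧ 2 * δ₀ < m₀) ∧ (∀ i, ContDiff ℝ (⊤ : ℕ∞) (M i) ∧ ContDiff ℝ (⊤ : ℕ∞) (a i) ∧ (∀ t, m₀ ≤ M i t ∧ M i t ≤ m₀⁻¹ ∧ |a i t| ≤ χ * M i t) ∧ ∀ n : ℕ, 1 ≤ n → Tendsto (iteratedDeriv n (M i)) atTop (𝓝 0) ∧ Tendsto (iteratedDeriv n (a i)) atTop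 (𝓝 0)) ∧ (∀ i, 0 < e i 0) ∧ Function.Injective e ∧ (∀ i, (U i : Set E4) = p i ⁻¹' {y : E4 | Kerr.rPlus (M i (y 0)) (a i (y 0)) - δ₀ < Kerr.radius (a i (y 0)) y}) ∧ (∀ i, S.IsLateChart (B i) Set.univ τ₀ (Ψ i) ∧ Ψ i '' ext i ⊆ O) ∧ (∀ i (k : ℕ) (R : ℝ), Tendsto (S.truncDeviationCk (B i) (Ψ i) k R) atTop (𝓝 0)) ∧ (∀ R : ℝ, ∃ τ₁, Pairwise (Disjoint on fun i ↦ Ψ i '' (B i).truncLateRegion τ₁ R)) ∧ (∀ i, Tendsto (fun t ↦ ρ i t / t) atTop (𝓝 0)) ∧ {x : E4 | τ₀ < x 0 ∧ ∀ i, ρ i (x 0) < E4.spatialNorm (p i x)} ⊆ ↑U₀ ∧ S.IsLateChart B₀ O τ₀ Ψ₀ ∧ Tendsto (S.deviationCk B₀ Ψ₀ 2) atTop (𝓝 0) ∧ O = exteriorOf 𝒞 (Ψ₀ '' B₀.lateRegion τ₀ ∪ ⋃ i, Ψ i '' ext i) ∧ (∀ τ₁ ≥ τ₀, RaysStayInClosure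 𝒞 (exteriorOf 𝒞 (Ψ₀ '' B₀.lateRegion τ₁))) ∧ (∀ i (ϱ : ℝ), ∀ᶠ τ in atTop, ∀ x ∈ (B i).truncTimeSlab ϱ τ, 𝒟.timeOrientation.IsFutureDirected (mfderiv 𝓘(ℝ, E4) (𝓡 4) (Ψ i) x (L i (Kerr.timeVector (M i (p i x.1 0)) (a i (p i x.1 0)) (p i x.1))))) ∧ (∀ᶠ τ in atTop, ∀ x ∈ B₀.timeSlab τ, 𝒟.timeOrientation.IsFutureDirected (mfderiv 𝓘(ℝ, E4) (𝓡 4) Ψ₀ x (E4.basisVector 0))) ∧ O \ ((⋃ i, Ψ i '' (B i).lateRegion τ₀) ∪ Ψ₀ '' B₀.lateRegion τ₀) ⊆ J ((⋃ i, Ψ i '' (B i).timeSlab τ₀) ∪ Ψ₀ '' B₀.timeSlab τ₀) ∧ (∃ C₁ C₂ : ℝ, ∀ i (x : U i) (y : U₀), τ₀ < (B i).time x.1 → Ψ i x = Ψ₀ y → ‖E4.spatial y.1 - ξ i (y.1 0)‖ ≤ C₂ * (B i).radius x.1 + C₁) ∧ (∃ C_W : ℝ, ∀ᶠ τ in atTop,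 ∀ x : U₀, x.1 0 = τ → let w := 1 + ⨅ i, ‖E4.spatial x.1 - ξ i τ‖; w ^ (9 / 10 : ℝ) * ‖h x.1‖ ≤ C_W ∧ ∀ m : ℕ, 1 ≤ m → m ≤ 2 → w * ‖iteratedFDeriv ℝ m h x.1‖ ≤ C_W) ∧ (∃ C_E : ℝ, ∀ᶠ τ in atTop, ∫⁻ y in {y : E3 | E4.ofTimeSpace τ y ∈ U₀}, ‖iteratedFDeriv ℝ 1 h (E4.ofTimeSpace τ y)‖ₑ ^ 2 ≤ ENNReal.ofReal C_E) ∧ ∃ R : Fin N → ℝ → ℝ, (∀ i, Tendsto (fun τ ↦ S.truncDeviationCk (B i) (Ψ i) 2 (R i τ) τ) atTop (𝓝 0)) ∧ ∀ τ₁ > τ₀, O \ (Ψ₀ '' B₀.lateRegion τ₁ ∪ ⋃ i, Ψ i '' {x | τ₁ < (B i).time x.1 ∧ (B i).radius x.1 ≤ R i ((B i).time x.1)}) ⊆ J (Ψ₀ '' B₀.timeSlab τ₁ ∪ ⋃ i, Ψ i '' (B i).truncTimeSlab (R i τ₁) τ₁))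

/-! ### Statements of the registered stubs, under the stub names
The skeleton audit reads the hypotheses of `ShapeSettledFinalEra_of` BY NAME: each head is a declared stub. -/
namespace Goal

/-- Statement of `stub_tameCensorship`. -/
abbrev stub_tameCensorship : Prop := TameCensorship
/-- Statement of `stub_captureAlongCensoredCurves`. -/
abbrev stub_captureAlongCensoredCurves : Prop := CaptureAlongCensoredCurves
/-- Statement of `stub_regularityDecayUpgrade`. -/
abbrev stub_regularityDecayUpgrade : Prop := RegularityDecayUpgrade

end Goal

/-! ## §2 Registered stubs (the three `sorry`s of the file), stated EXPANDED over existing declarations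
(Statement + Literature prelude only; no vocabulary of this file occurs in a stub signature). -/

/-- **Stub 1** (XL, open-problem): tame weak cosmic censorship with MGHD existence — see `TameCensorship`.
[cite: Christodoulou1999, p. A24] -/
theorem stub_tameCensorship :
    ∀ (X : Type) [TopologicalSpace X] [ChartedSpace E3 X] [IsManifold (𝓡 3) (⊤ : ℕ∞) X] [T2Space X] [SecondCountableTopology X] [ConnectedSpace X], InitialDataSet.IsTameChristodoulouGeneric (admissibleVacuumData X) (fun D ↦ (∃ 𝒟 : VacuumCauchyDevelopment D, 𝒟.IsMaximal) ∧ ∀ 𝒟 : VacuumCauchyDevelopment D, 𝒟.IsMaximal → HasCompleteNullInfinity 𝒟.toCauchyDevelopment) 1 := by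
  sorry

/-- **Stub 2** (XL, open-problem): large-data Kerr-family capture along censored curves, `C²` currency — see
`CaptureAlongCensoredCurves`. [cite: DafermosLuk2017, Conjecture 1] -/
theorem stub_captureAlongCensoredCurves :
    ∀ (X : Type) [TopologicalSpace X] [ChartedSpace E3 X] [IsManifold (𝓡 3) (⊤ : ℕ∞) X] [T2Space X] [SecondCountableTopology X] [ConnectedSpace X], ∀ (e : AFEnd X) (F : EuclideanSpace ℝ (Fin 1) → InitialDataSet (𝓡 3) X), InitialDataSet.IsTameDataFamily e 1 F → ((InitialDataSet.IsImmersedAtZero 1 F ∧ Function.Injective F) ∨ ∀ c, F c = F 0) → (∀ c, F c ∈ admissibleVacuumData X) → (∀ c ≠ 0, (∃ 𝒟 : VacuumCauchyDevelopment (F c), 𝒟.IsMaximal) ∧ ∀ 𝒟 : VacuumCauchyDevelopment (F c), 𝒟.IsMaximal → HasCompleteNullInfinity 𝒟.toCauchyDevelopment) → ∃ (e' : AFEnd X) (F' : EuclideanSpace ℝ (Fin 1) → InitialDataSet (𝓡 3) X), InitialDataSet.IsTameDataFamily e' 1 F' ∧ InitialDataSet.IsImmersedAtZero 1 F' ∧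 F' 0 = F 0 ∧ Function.Injective F' ∧ (∀ c, F' c ∈ admissibleVacuumData X) ∧ ∃ ε > (0 : ℝ), ∀ c, c ≠ 0 → ‖c‖ < ε → ((∃ 𝒟 : VacuumCauchyDevelopment (F' c), 𝒟.IsMaximal) ∧ ∀ 𝒟 : VacuumCauchyDevelopment (F' c), 𝒟.IsMaximal → HasCompleteNullInfinity 𝒟.toCauchyDevelopment ∧ ∃ (N : ℕ) (m₀ χ τ₀ δ₀ : ℝ) (M a : Fin N → ℝ → ℝ) (motion : Fin N → lorentzGroup × E4) (U : Fin N → Opens E4) (Ψ : ∀ i, U i → 𝒟.carrier) (ρ : Fin N → ℝ → ℝ) (U₀ : Opens E4) (Ψ₀ : U₀ → 𝒟.carrier) (O : Set 𝒟.carrier), (let S := 𝒟.toSpacetime; let 𝒞 := 𝒟.toCauchyDevelopment; let J := 𝒟.metric.causalPast 𝒟.timeOrientation; let L := fun i ↦ ((motion i).1 : E4 ≃L[ℝ] E4); let p := fun i ↦ poincareInv (motion i).1 (motion i).2; let e := fun i ↦ L i (E4.basisVector 0); let B : Fin N → ModelBackground := fun i ↦ ⟨U i, fun x ↦ boostedKerrBilin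 (motion i).1 (motion i).2 (M i (p i x 0)) (a i (p i x 0)) x, fun x ↦ p i x 0, fun x ↦ Kerr.radius (a i (p i x 0)) (p i x)⟩; let ξ := fun i (t : ℝ) ↦ E4.spatial (((t - (motion i).2 0) / e i 0) • e i + (motion i).2); let B₀ := Minkowski.backgroundOn U₀; let ext := fun i ↦ (B i).lateRegion τ₀ ∩ {x | Kerr.rPlus (M i (p i x.1 0)) (a i (p i x.1 0)) < (B i).radius x.1}; (0 < m₀ ∧ 0 ≤ χ ∧ χ < 1 ∧ 0 < δ₀ ∧ 2 * δ₀ < m₀) ∧ (∀ i, ContDiff ℝ (⊤ : ℕ∞) (M i) ∧ ContDiff ℝ (⊤ : ℕ∞) (a i) ∧ (∀ t, m₀ ≤ M i t ∧ M i t ≤ m₀⁻¹ ∧ |a i t| ≤ χ * M i t) ∧ ∀ n : ℕ, 1 ≤ n → Tendsto (iteratedDeriv n (M i)) atTop (𝓝 0) ∧ Tendsto (iteratedDeriv n (a i)) atTop (𝓝 0)) ∧ (∀ i, 0 < e i 0) ∧ Function.Injective e ∧ (∀ i, (U i : Set E4) = p i ⁻¹' {y : E4 | Kerr.rPlus (M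 i (y 0)) (a i (y 0)) - δ₀ < Kerr.radius (a i (y 0)) y}) ∧ (∀ i, S.IsLateChart (B i) Set.univ τ₀ (Ψ i) ∧ Ψ i '' ext i ⊆ O) ∧ (∀ i (R : ℝ), Tendsto (S.truncDeviationCk (B i) (Ψ i) 2 R) atTop (𝓝 0)) ∧ (∀ R : ℝ, ∃ τ₁, Pairwise (Disjoint on fun i ↦ Ψ i '' (B i).truncLateRegion τ₁ R)) ∧ (∀ i, Tendsto (fun t ↦ ρ i t / t) atTop (𝓝 0)) ∧ {x : E4 | τ₀ < x 0 ∧ ∀ i, ρ i (x 0) < E4.spatialNorm (p i x)} ⊆ ↑U₀ ∧ S.IsLateChart B₀ O τ₀ Ψ₀ ∧ Tendsto (S.deviationCk B₀ Ψ₀ 2) atTop (𝓝 0) ∧ O = exteriorOf 𝒞 (Ψ₀ '' B₀.lateRegion τ₀ ∪ ⋃ i, Ψ i '' ext i) ∧ (∀ τ₁ ≥ τ₀, RaysStayInClosure 𝒞 (exteriorOf 𝒞 (Ψ₀ '' B₀.lateRegion τ₁))) ∧ (∀ i (ϱ : ℝ), ∀ᶠ τ in atTop, ∀ x ∈ (B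 i).truncTimeSlab ϱ τ, 𝒟.timeOrientation.IsFutureDirected (mfderiv 𝓘(ℝ, E4) (𝓡 4) (Ψ i) x (L i (Kerr.timeVector (M i (p i x.1 0)) (a i (p i x.1 0)) (p i x.1))))) ∧ (∀ᶠ τ in atTop, ∀ x ∈ B₀.timeSlab τ, 𝒟.timeOrientation.IsFutureDirected (mfderiv 𝓘(ℝ, E4) (𝓡 4) Ψ₀ x (E4.basisVector 0))) ∧ O \ ((⋃ i, Ψ i '' (B i).lateRegion τ₀) ∪ Ψ₀ '' B₀.lateRegion τ₀) ⊆ J ((⋃ i, Ψ i '' (B i).timeSlab τ₀) ∪ Ψ₀ '' B₀.timeSlab τ₀) ∧ (∃ C₁ C₂ : ℝ, ∀ i (x : U i) (y : U₀), τ₀ < (B i).time x.1 → Ψ i x = Ψ₀ y → ‖E4.spatial y.1 - ξ i (y.1 0)‖ ≤ C₂ * (B i).radius x.1 + C₁) ∧ ∃ R : Fin N → ℝ → ℝ, (∀ i, Tendsto (fun τ ↦ S.truncDeviationCk (B i) (Ψ i) 2 (R i τ) τ) atTop (𝓝 0)) ∧ ∀ τ₁ > τ₀, O \ (Ψ₀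 '' B₀.lateRegion τ₁ ∪ ⋃ i, Ψ i '' {x | τ₁ < (B i).time x.1 ∧ (B i).radius x.1 ≤ R i ((B i).time x.1)}) ⊆ J (Ψ₀ '' B₀.timeSlab τ₁ ∪ ⋃ i, Ψ i '' (B i).truncTimeSlab (R i τ₁) τ₁))) := by
  sorry

/-- **Stub 3** (L): regularity and far-field decay upgrade, universal — see `RegularityDecayUpgrade`.
[cite: arXiv210408222, §1] -/
theorem stub_regularityDecayUpgrade :
    ∀ (X : Type) [TopologicalSpace X] [ChartedSpace E3 X] [IsManifold (𝓡 3) (⊤ : ℕ∞) X] [T2Space X] [SecondCountableTopology X] [ConnectedSpace X], ∀ D ∈ admissibleVacuumData X, ∀ 𝒟 : VacuumCauchyDevelopment D, 𝒟.IsMaximal → HasCompleteNullInfinity 𝒟.toCauchyDevelopment → (∃ (N : ℕ) (m₀ χ τ₀ δ₀ : ℝ) (M a : Fin N → ℝ → ℝ) (motion : Fin N → lorentzGroup × E4) (U : Fin N → Opens E4) (Ψ : ∀ i, U i → 𝒟.carrier) (ρ : Fin N → ℝ → ℝ) (U₀ : Opens E4) (Ψ₀ : U₀ → 𝒟.carrier)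 (O : Set 𝒟.carrier), (let S := 𝒟.toSpacetime; let 𝒞 := 𝒟.toCauchyDevelopment; let J := 𝒟.metric.causalPast 𝒟.timeOrientation; let L := fun i ↦ ((motion i).1 : E4 ≃L[ℝ] E4); let p := fun i ↦ poincareInv (motion i).1 (motion i).2; let e := fun i ↦ L i (E4.basisVector 0); let B : Fin N → ModelBackground := fun i ↦ ⟨U i, fun x ↦ boostedKerrBilin (motion i).1 (motion i).2 (M i (p i x 0)) (a i (p i x 0)) x, fun x ↦ p i x 0, fun x ↦ Kerr.radius (a i (p i x 0)) (p i x)⟩; let ξ := fun i (t : ℝ) ↦ E4.spatial (((t - (motion i).2 0) / e i 0) • e i + (motion i).2); let B₀ := Minkowski.backgroundOn U₀; let ext := fun i ↦ (B i).lateRegion τ₀ ∩ {x | Kerr.rPlus (M i (p i x.1 0)) (a i (p i x.1 0)) < (B i).radius x.1}; (0 < m₀ ∧ 0 ≤ χ ∧ χ < 1 ∧ 0 < δ₀ ∧ 2 * δ₀ < m₀) ∧ (∀ i, ContDiff ℝ (⊤ : ℕ∞) (M i) ∧ ContDiff ℝ (⊤ : ℕ∞) (a i) ∧ (∀ t, m₀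 ≤ M i t ∧ M i t ≤ m₀⁻¹ ∧ |a i t| ≤ χ * M i t) ∧ ∀ n : ℕ, 1 ≤ n → Tendsto (iteratedDeriv n (M i)) atTop (𝓝 0) ∧ Tendsto (iteratedDeriv n (a i)) atTop (𝓝 0)) ∧ (∀ i, 0 < e i 0) ∧ Function.Injective e ∧ (∀ i, (U i : Set E4) = p i ⁻¹' {y : E4 | Kerr.rPlus (M i (y 0)) (a i (y 0)) - δ₀ < Kerr.radius (a i (y 0)) y}) ∧ (∀ i, S.IsLateChart (B i) Set.univ τ₀ (Ψ i) ∧ Ψ i '' ext i ⊆ O) ∧ (∀ i (R : ℝ), Tendsto (S.truncDeviationCk (B i) (Ψ i) 2 R) atTop (𝓝 0)) ∧ (∀ R : ℝ, ∃ τ₁, Pairwise (Disjoint on fun i ↦ Ψ i '' (B i).truncLateRegion τ₁ R)) ∧ (∀ i, Tendsto (fun t ↦ ρ i t / t) atTop (𝓝 0)) ∧ {x : E4 | τ₀ < x 0 ∧ ∀ i, ρ i (x 0) < E4.spatialNorm (p i x)} ⊆ ↑U₀ ∧ S.IsLateChart B₀ O τ₀ Ψ₀ ∧ Tendsto (S.deviationCk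 B₀ Ψ₀ 2) atTop (𝓝 0) ∧ O = exteriorOf 𝒞 (Ψ₀ '' B₀.lateRegion τ₀ ∪ ⋃ i, Ψ i '' ext i) ∧ (∀ τ₁ ≥ τ₀, RaysStayInClosure 𝒞 (exteriorOf 𝒞 (Ψ₀ '' B₀.lateRegion τ₁))) ∧ (∀ i (ϱ : ℝ), ∀ᶠ τ in atTop, ∀ x ∈ (B i).truncTimeSlab ϱ τ, 𝒟.timeOrientation.IsFutureDirected (mfderiv 𝓘(ℝ, E4) (𝓡 4) (Ψ i) x (L i (Kerr.timeVector (M i (p i x.1 0)) (a i (p i x.1 0)) (p i x.1))))) ∧ (∀ᶠ τ in atTop, ∀ x ∈ B₀.timeSlab τ, 𝒟.timeOrientation.IsFutureDirected (mfderiv 𝓘(ℝ, E4) (𝓡 4) Ψ₀ x (E4.basisVector 0))) ∧ O \ ((⋃ i, Ψ i '' (B i).lateRegion τ₀) ∪ Ψ₀ '' B₀.lateRegion τ₀) ⊆ J ((⋃ i, Ψ i '' (B i).timeSlab τ₀) ∪ Ψ₀ '' B₀.timeSlab τ₀) ∧ (∃ C₁ C₂ : ℝ, ∀ i (x : U i)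 (y : U₀), τ₀ < (B i).time x.1 → Ψ i x = Ψ₀ y → ‖E4.spatial y.1 - ξ i (y.1 0)‖ ≤ C₂ * (B i).radius x.1 + C₁) ∧ ∃ R : Fin N → ℝ → ℝ, (∀ i, Tendsto (fun τ ↦ S.truncDeviationCk (B i) (Ψ i) 2 (R i τ) τ) atTop (𝓝 0)) ∧ ∀ τ₁ > τ₀, O \ (Ψ₀ '' B₀.lateRegion τ₁ ∪ ⋃ i, Ψ i '' {x | τ₁ < (B i).time x.1 ∧ (B i).radius x.1 ≤ R i ((B i).time x.1)}) ⊆ J (Ψ₀ '' B₀.timeSlab τ₁ ∪ ⋃ i, Ψ i '' (B i).truncTimeSlab (R i τ₁) τ₁))) → ∃ (N : ℕ) (m₀ χ τ₀ δ₀ : ℝ) (M a : Fin N → ℝ → ℝ) (motion : Fin N → lorentzGroup × E4) (U : Fin N → Opens E4) (Ψ : ∀ i, U i → 𝒟.carrier) (ρ : Fin N → ℝ → ℝ) (U₀ : Opens E4) (Ψ₀ : U₀ → 𝒟.carrier) (O : Set 𝒟.carrier), (let S := 𝒟.toSpacetime; let 𝒞 := 𝒟.toCauchyDevelopment; let J :=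 𝒟.metric.causalPast 𝒟.timeOrientation; let L := fun i ↦ ((motion i).1 : E4 ≃L[ℝ] E4); let p := fun i ↦ poincareInv (motion i).1 (motion i).2; let e := fun i ↦ L i (E4.basisVector 0); let B : Fin N → ModelBackground := fun i ↦ ⟨U i, fun x ↦ boostedKerrBilin (motion i).1 (motion i).2 (M i (p i x 0)) (a i (p i x 0)) x, fun x ↦ p i x 0, fun x ↦ Kerr.radius (a i (p i x 0)) (p i x)⟩; let ξ := fun i (t : ℝ) ↦ E4.spatial (((t - (motion i).2 0) / e i 0) • e i + (motion i).2); let B₀ := Minkowski.backgroundOn U₀; let h := S.deviationExtend B₀ Ψ₀; let ext := fun i ↦ (B i).lateRegion τ₀ ∩ {x | Kerr.rPlus (M i (p i x.1 0)) (a i (p i x.1 0)) < (B i).radius x.1}; (0 < m₀ ∧ 0 ≤ χ ∧ χ < 1 ∧ 0 < δ₀ ∧ 2 * δ₀ < m₀) ∧ (∀ i, ContDiff ℝ (⊤ : ℕ∞) (M i) ∧ ContDiff ℝ (⊤ : ℕ∞) (a i) ∧ (∀ t, m₀ ≤ M i t ∧ M i t ≤ m₀⁻¹ ∧ |a i t|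 ≤ χ * M i t) ∧ ∀ n : ℕ, 1 ≤ n → Tendsto (iteratedDeriv n (M i)) atTop (𝓝 0) ∧ Tendsto (iteratedDeriv n (a i)) atTop (𝓝 0)) ∧ (∀ i, 0 < e i 0) ∧ Function.Injective e ∧ (∀ i, (U i : Set E4) = p i ⁻¹' {y : E4 | Kerr.rPlus (M i (y 0)) (a i (y 0)) - δ₀ < Kerr.radius (a i (y 0)) y}) ∧ (∀ i, S.IsLateChart (B i) Set.univ τ₀ (Ψ i) ∧ Ψ i '' ext i ⊆ O) ∧ (∀ i (k : ℕ) (R : ℝ), Tendsto (S.truncDeviationCk (B i) (Ψ i) k R) atTop (𝓝 0)) ∧ (∀ R : ℝ, ∃ τ₁, Pairwise (Disjoint on fun i ↦ Ψ i '' (B i).truncLateRegion τ₁ R)) ∧ (∀ i, Tendsto (fun t ↦ ρ i t / t) atTop (𝓝 0)) ∧ {x : E4 | τ₀ < x 0 ∧ ∀ i, ρ i (x 0) < E4.spatialNorm (p i x)} ⊆ ↑U₀ ∧ S.IsLateChart B₀ O τ₀ Ψ₀ ∧ Tendsto (S.deviationCk B₀ Ψ₀ 2) atTop (𝓝 0)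 ∧ O = exteriorOf 𝒞 (Ψ₀ '' B₀.lateRegion τ₀ ∪ ⋃ i, Ψ i '' ext i) ∧ (∀ τ₁ ≥ τ₀, RaysStayInClosure 𝒞 (exteriorOf 𝒞 (Ψ₀ '' B₀.lateRegion τ₁))) ∧ (∀ i (ϱ : ℝ), ∀ᶠ τ in atTop, ∀ x ∈ (B i).truncTimeSlab ϱ τ, 𝒟.timeOrientation.IsFutureDirected (mfderiv 𝓘(ℝ, E4) (𝓡 4) (Ψ i) x (L i (Kerr.timeVector (M i (p i x.1 0)) (a i (p i x.1 0)) (p i x.1))))) ∧ (∀ᶠ τ in atTop, ∀ x ∈ B₀.timeSlab τ, 𝒟.timeOrientation.IsFutureDirected (mfderiv 𝓘(ℝ, E4) (𝓡 4) Ψ₀ x (E4.basisVector 0))) ∧ O \ ((⋃ i, Ψ i '' (B i).lateRegion τ₀) ∪ Ψ₀ '' B₀.lateRegion τ₀) ⊆ J ((⋃ i, Ψ i '' (B i).timeSlab τ₀) ∪ Ψ₀ '' B₀.timeSlab τ₀) ∧ (∃ C₁ C₂ : ℝ, ∀ i (x : U i) (y : U₀), τ₀ < (B i).time x.1 → Ψ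 i x = Ψ₀ y → ‖E4.spatial y.1 - ξ i (y.1 0)‖ ≤ C₂ * (B i).radius x.1 + C₁) ∧ (∃ C_W : ℝ, ∀ᶠ τ in atTop, ∀ x : U₀, x.1 0 = τ → let w := 1 + ⨅ i, ‖E4.spatial x.1 - ξ i τ‖; w ^ (9 / 10 : ℝ) * ‖h x.1‖ ≤ C_W ∧ ∀ m : ℕ, 1 ≤ m → m ≤ 2 → w * ‖iteratedFDeriv ℝ m h x.1‖ ≤ C_W) ∧ (∃ C_E : ℝ, ∀ᶠ τ in atTop, ∫⁻ y in {y : E3 | E4.ofTimeSpace τ y ∈ U₀}, ‖iteratedFDeriv ℝ 1 h (E4.ofTimeSpace τ y)‖ₑ ^ 2 ≤ ENNReal.ofReal C_E) ∧ ∃ R : Fin N → ℝ → ℝ, (∀ i, Tendsto (fun τ ↦ S.truncDeviationCk (B i) (Ψ i) 2 (R i τ) τ) atTop (𝓝 0)) ∧ ∀ τ₁ > τ₀, O \ (Ψ₀ '' B₀.lateRegion τ₁ ∪ ⋃ i, Ψ i '' {x | τ₁ < (B i).time x.1 ∧ (B i).radius x.1 ≤ R i ((B i).time x.1)}) ⊆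 J (Ψ₀ '' B₀.timeSlab τ₁ ∪ ⋃ i, Ψ i '' (B i).truncTimeSlab (R i τ₁) τ₁)) := by
  sorry

/-! ## §3 The composition (kernel-checked; no `sorry` of its own) -/

/-- **THE CRUX BY NAME** from the three registered stubs: constant curves through admissible data are tame
(`exists_isSoleEnd_of_mem_admissibleVacuumData`, `isTameDataFamily_const` inside `relative'`); the relative
composition `isTameChristodoulouGeneric_of_relative'` with `Q = censored` (Stub 1) and the Stub-2 witnesses,
globalised in the parameter by the landed `exists_tameCurve_of_local`, makes the `C²`-settled property `P₀`
tame-generic; monotonicity `IsTameChristodoulouGeneric.mono` with Stub 3 applied MGHD by MGHD gives the crux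
verbatim. [folklore] -/
theorem ShapeSettledFinalEra_of :
    Goal.stub_tameCensorship → Goal.stub_captureAlongCensoredCurves → Goal.stub_regularityDecayUpgrade →
      Summit.FinalStateConjecture.FinalStateConjecture.Theses.RecedingSphereBudgets.ShapeSettledFinalEra := by
  intro h₁ h₂ h₃ X _ _ _ _ _ _
  -- (0) every admissible datum has a sole, strongly asymptotically flat end (constant curves are tame)
  have h𝓓 : ∀ d ∈ admissibleVacuumData X,
      ∃ e : AFEnd X, e.IsSoleEnd ∧ ∃ M : ℝ, e.IsStronglyAsymptoticallyFlatDR d M :=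
    fun d hd ↦ exists_isSoleEnd_of_mem_admissibleVacuumData hd
  -- (1) relative composition: censorship (Stub 1) is the generic hypothesis `Q`; Stub 2 hands back, along every
  --     censored tame curve, a locally `P₀`-settled tame immersed injective curve, globalised by the landed
  --     radial reparametrisation; hence `P₀`-settling is tame-generic.
  have key : InitialDataSet.IsTameChristodoulouGeneric (admissibleVacuumData X)
      (fun D ↦ (∃ 𝒟 : VacuumCauchyDevelopment D, 𝒟.IsMaximal) ∧ ∀ 𝒟 : VacuumCauchyDevelopment D, 𝒟.IsMaximal → HasCompleteNullInfinity 𝒟.toCauchyDevelopment ∧ ∃ (N : ℕ) (m₀ χ τ₀ δ₀ : ℝ) (M a : Fin N → ℝ → ℝ) (motion : Fin N → lorentzGroup × E4) (U : Fin N → Opens E4) (Ψ : ∀ i, U i → 𝒟.carrier) (ρ : Fin N → ℝ → ℝ) (U₀ : Opens E4) (Ψ₀ : U₀ → 𝒟.carrier) (O : Set 𝒟.carrier), (let S := 𝒟.toSpacetime; let 𝒞 := 𝒟.toCauchyDevelopment; let J := 𝒟.metric.causalPast 𝒟.timeOrientation; let L := fun i ↦ ((motion i).1 : E4 ≃L[ℝ]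 E4); let p := fun i ↦ poincareInv (motion i).1 (motion i).2; let e := fun i ↦ L i (E4.basisVector 0); let B : Fin N → ModelBackground := fun i ↦ ⟨U i, fun x ↦ boostedKerrBilin (motion i).1 (motion i).2 (M i (p i x 0)) (a i (p i x 0)) x, fun x ↦ p i x 0, fun x ↦ Kerr.radius (a i (p i x 0)) (p i x)⟩; let ξ := fun i (t : ℝ) ↦ E4.spatial (((t - (motion i).2 0) / e i 0) • e i + (motion i).2); let B₀ := Minkowski.backgroundOn U₀; let ext := fun i ↦ (B i).lateRegion τ₀ ∩ {x | Kerr.rPlus (M i (p i x.1 0)) (a i (p i x.1 0)) < (B i).radius x.1}; (0 < m₀ ∧ 0 ≤ χ ∧ χ < 1 ∧ 0 < δ₀ ∧ 2 * δ₀ < m₀) ∧ (∀ i, ContDiff ℝ (⊤ : ℕ∞) (M i) ∧ ContDiff ℝ (⊤ : ℕ∞) (a i) ∧ (∀ t, m₀ ≤ M i t ∧ M i t ≤ m₀⁻¹ ∧ |a i t| ≤ χ * M i t) ∧ ∀ n : ℕ, 1 ≤ n → Tendsto (iteratedDeriv n (M i)) atTop (𝓝 0) ∧ Tendsto (iteratedDeriv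 n (a i)) atTop (𝓝 0)) ∧ (∀ i, 0 < e i 0) ∧ Function.Injective e ∧ (∀ i, (U i : Set E4) = p i ⁻¹' {y : E4 | Kerr.rPlus (M i (y 0)) (a i (y 0)) - δ₀ < Kerr.radius (a i (y 0)) y}) ∧ (∀ i, S.IsLateChart (B i) Set.univ τ₀ (Ψ i) ∧ Ψ i '' ext i ⊆ O) ∧ (∀ i (R : ℝ), Tendsto (S.truncDeviationCk (B i) (Ψ i) 2 R) atTop (𝓝 0)) ∧ (∀ R : ℝ, ∃ τ₁, Pairwise (Disjoint on fun i ↦ Ψ i '' (B i).truncLateRegion τ₁ R)) ∧ (∀ i, Tendsto (fun t ↦ ρ i t / t) atTop (𝓝 0)) ∧ {x : E4 | τ₀ < x 0 ∧ ∀ i, ρ i (x 0) < E4.spatialNorm (p i x)} ⊆ ↑U₀ ∧ S.IsLateChart B₀ O τ₀ Ψ₀ ∧ Tendsto (S.deviationCk B₀ Ψ₀ 2) atTop (𝓝 0) ∧ O = exteriorOf 𝒞 (Ψ₀ '' B₀.lateRegion τ₀ ∪ ⋃ i, Ψ i '' ext i) ∧ (∀ τ₁ ≥ τ₀, RaysStayInClosure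 𝒞 (exteriorOf 𝒞 (Ψ₀ '' B₀.lateRegion τ₁))) ∧ (∀ i (ϱ : ℝ), ∀ᶠ τ in atTop, ∀ x ∈ (B i).truncTimeSlab ϱ τ, 𝒟.timeOrientation.IsFutureDirected (mfderiv 𝓘(ℝ, E4) (𝓡 4) (Ψ i) x (L i (Kerr.timeVector (M i (p i x.1 0)) (a i (p i x.1 0)) (p i x.1))))) ∧ (∀ᶠ τ in atTop, ∀ x ∈ B₀.timeSlab τ, 𝒟.timeOrientation.IsFutureDirected (mfderiv 𝓘(ℝ, E4) (𝓡 4) Ψ₀ x (E4.basisVector 0))) ∧ O \ ((⋃ i, Ψ i '' (B i).lateRegion τ₀) ∪ Ψ₀ '' B₀.lateRegion τ₀) ⊆ J ((⋃ i, Ψ i '' (B i).timeSlab τ₀) ∪ Ψ₀ '' B₀.timeSlab τ₀) ∧ (∃ C₁ C₂ : ℝ, ∀ i (x : U i) (y : U₀), τ₀ < (B i).time x.1 → Ψ i x = Ψ₀ y → ‖E4.spatial y.1 - ξ i (y.1 0)‖ ≤ C₂ * (B i).radius x.1 + C₁) ∧ ∃ R : Fin N → ℝ → ℝ, (∀ i,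 Tendsto (fun τ ↦ S.truncDeviationCk (B i) (Ψ i) 2 (R i τ) τ) atTop (𝓝 0)) ∧ ∀ τ₁ > τ₀, O \ (Ψ₀ '' B₀.lateRegion τ₁ ∪ ⋃ i, Ψ i '' {x | τ₁ < (B i).time x.1 ∧ (B i).radius x.1 ≤ R i ((B i).time x.1)}) ⊆ J (Ψ₀ '' B₀.timeSlab τ₁ ∪ ⋃ i, Ψ i '' (B i).truncTimeSlab (R i τ₁) τ₁))) 1 := by
    refine InitialDataSet.isTameChristodoulouGeneric_of_relative'
      (P := fun D ↦ (∃ 𝒟 : VacuumCauchyDevelopment D, 𝒟.IsMaximal) ∧ ∀ 𝒟 : VacuumCauchyDevelopment D, 𝒟.IsMaximal → HasCompleteNullInfinity 𝒟.toCauchyDevelopment ∧ ∃ (N : ℕ) (m₀ χ τ₀ δ₀ : ℝ) (M a : Fin N → ℝ → ℝ) (motion : Fin N → lorentzGroup × E4) (U : Fin N → Opens E4) (Ψ : ∀ i, U i → 𝒟.carrier) (ρ : Fin N → ℝ → ℝ) (U₀ : Opens E4) (Ψ₀ : U₀ → 𝒟.carrier) (O : Set 𝒟.carrier), (let S := 𝒟.toSpacetime;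 let 𝒞 := 𝒟.toCauchyDevelopment; let J := 𝒟.metric.causalPast 𝒟.timeOrientation; let L := fun i ↦ ((motion i).1 : E4 ≃L[ℝ] E4); let p := fun i ↦ poincareInv (motion i).1 (motion i).2; let e := fun i ↦ L i (E4.basisVector 0); let B : Fin N → ModelBackground := fun i ↦ ⟨U i, fun x ↦ boostedKerrBilin (motion i).1 (motion i).2 (M i (p i x 0)) (a i (p i x 0)) x, fun x ↦ p i x 0, fun x ↦ Kerr.radius (a i (p i x 0)) (p i x)⟩; let ξ := fun i (t : ℝ) ↦ E4.spatial (((t - (motion i).2 0) / e i 0) • e i + (motion i).2); let B₀ := Minkowski.backgroundOn U₀; let ext := fun i ↦ (B i).lateRegion τ₀ ∩ {x | Kerr.rPlus (M i (p i x.1 0)) (a i (p i x.1 0)) < (B i).radius x.1}; (0 < m₀ ∧ 0 ≤ χ ∧ χ < 1 ∧ 0 < δ₀ ∧ 2 * δ₀ < m₀) ∧ (∀ i, ContDiff ℝ (⊤ : ℕ∞) (M i) ∧ ContDiff ℝ (⊤ : ℕ∞) (a i) ∧ (∀ t, m₀ ≤ M i t ∧ M i t ≤ m₀⁻¹ ∧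 |a i t| ≤ χ * M i t) ∧ ∀ n : ℕ, 1 ≤ n → Tendsto (iteratedDeriv n (M i)) atTop (𝓝 0) ∧ Tendsto (iteratedDeriv n (a i)) atTop (𝓝 0)) ∧ (∀ i, 0 < e i 0) ∧ Function.Injective e ∧ (∀ i, (U i : Set E4) = p i ⁻¹' {y : E4 | Kerr.rPlus (M i (y 0)) (a i (y 0)) - δ₀ < Kerr.radius (a i (y 0)) y}) ∧ (∀ i, S.IsLateChart (B i) Set.univ τ₀ (Ψ i) ∧ Ψ i '' ext i ⊆ O) ∧ (∀ i (R : ℝ), Tendsto (S.truncDeviationCk (B i) (Ψ i) 2 R) atTop (𝓝 0)) ∧ (∀ R : ℝ, ∃ τ₁, Pairwise (Disjoint on fun i ↦ Ψ i '' (B i).truncLateRegion τ₁ R)) ∧ (∀ i, Tendsto (fun t ↦ ρ i t / t) atTop (𝓝 0)) ∧ {x : E4 | τ₀ < x 0 ∧ ∀ i, ρ i (x 0) < E4.spatialNorm (p i x)} ⊆ ↑U₀ ∧ S.IsLateChart B₀ O τ₀ Ψ₀ ∧ Tendsto (S.deviationCk B₀ Ψ₀ 2) atTop (𝓝 0) ∧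 O = exteriorOf 𝒞 (Ψ₀ '' B₀.lateRegion τ₀ ∪ ⋃ i, Ψ i '' ext i) ∧ (∀ τ₁ ≥ τ₀, RaysStayInClosure 𝒞 (exteriorOf 𝒞 (Ψ₀ '' B₀.lateRegion τ₁))) ∧ (∀ i (ϱ : ℝ), ∀ᶠ τ in atTop, ∀ x ∈ (B i).truncTimeSlab ϱ τ, 𝒟.timeOrientation.IsFutureDirected (mfderiv 𝓘(ℝ, E4) (𝓡 4) (Ψ i) x (L i (Kerr.timeVector (M i (p i x.1 0)) (a i (p i x.1 0)) (p i x.1))))) ∧ (∀ᶠ τ in atTop, ∀ x ∈ B₀.timeSlab τ, 𝒟.timeOrientation.IsFutureDirected (mfderiv 𝓘(ℝ, E4) (𝓡 4) Ψ₀ x (E4.basisVector 0))) ∧ O \ ((⋃ i, Ψ i '' (B i).lateRegion τ₀) ∪ Ψ₀ '' B₀.lateRegion τ₀) ⊆ J ((⋃ i, Ψ i '' (B i).timeSlab τ₀) ∪ Ψ₀ '' B₀.timeSlab τ₀) ∧ (∃ C₁ C₂ : ℝ, ∀ i (x : U i) (y : U₀), τ₀ < (B i).time x.1 → Ψ i x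 = Ψ₀ y → ‖E4.spatial y.1 - ξ i (y.1 0)‖ ≤ C₂ * (B i).radius x.1 + C₁) ∧ ∃ R : Fin N → ℝ → ℝ, (∀ i, Tendsto (fun τ ↦ S.truncDeviationCk (B i) (Ψ i) 2 (R i τ) τ) atTop (𝓝 0)) ∧ ∀ τ₁ > τ₀, O \ (Ψ₀ '' B₀.lateRegion τ₁ ∪ ⋃ i, Ψ i '' {x | τ₁ < (B i).time x.1 ∧ (B i).radius x.1 ≤ R i ((B i).time x.1)}) ⊆ J (Ψ₀ '' B₀.timeSlab τ₁ ∪ ⋃ i, Ψ i '' (B i).truncTimeSlab (R i τ₁) τ₁))) h𝓓 (h₁ X) ?_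
    intro e F hF hdich hadm hQ
    obtain ⟨e', F', hF', himm', h0', hinj', hadm', ε, hε, hP⟩ := h₂ X e F hF hdich hadm hQ
    exact InitialDataSet.exists_tameCurve_of_local
      (P := fun D ↦ (∃ 𝒟 : VacuumCauchyDevelopment D, 𝒟.IsMaximal) ∧ ∀ 𝒟 : VacuumCauchyDevelopment D, 𝒟.IsMaximal → HasCompleteNullInfinity 𝒟.toCauchyDevelopment ∧ ∃ (N : ℕ) (m₀ χ τ₀ δ₀ : ℝ) (M a : Fin N → ℝ → ℝ) (motion : Fin N → lorentzGroup × E4) (U : Fin N → Opens E4) (Ψ : ∀ i, U i → 𝒟.carrier) (ρ : Fin N → ℝ → ℝ) (U₀ : Opens E4) (Ψ₀ : U₀ → 𝒟.carrier) (O : Set 𝒟.carrier), (let S := 𝒟.toSpacetime; let 𝒞 := 𝒟.toCauchyDevelopment; let J := 𝒟.metric.causalPast 𝒟.timeOrientation; let L := fun i ↦ ((motion i).1 : E4 ≃L[ℝ] E4); let p := fun i ↦ poincareInv (motion i).1 (motion i).2; let e := fun i ↦ L i (E4.basisVector 0); let B : Fin N → ModelBackground := fun i ↦ ⟨U i, fun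 x ↦ boostedKerrBilin (motion i).1 (motion i).2 (M i (p i x 0)) (a i (p i x 0)) x, fun x ↦ p i x 0, fun x ↦ Kerr.radius (a i (p i x 0)) (p i x)⟩; let ξ := fun i (t : ℝ) ↦ E4.spatial (((t - (motion i).2 0) / e i 0) • e i + (motion i).2); let B₀ := Minkowski.backgroundOn U₀; let ext := fun i ↦ (B i).lateRegion τ₀ ∩ {x | Kerr.rPlus (M i (p i x.1 0)) (a i (p i x.1 0)) < (B i).radius x.1}; (0 < m₀ ∧ 0 ≤ χ ∧ χ < 1 ∧ 0 < δ₀ ∧ 2 * δ₀ < m₀) ∧ (∀ i, ContDiff ℝ (⊤ : ℕ∞) (M i) ∧ ContDiff ℝ (⊤ : ℕ∞) (a i) ∧ (∀ t, m₀ ≤ M i t ∧ M i t ≤ m₀⁻¹ ∧ |a i t| ≤ χ * M i t) ∧ ∀ n : ℕ, 1 ≤ n → Tendsto (iteratedDeriv n (M i)) atTop (𝓝 0) ∧ Tendsto (iteratedDeriv n (a i)) atTop (𝓝 0)) ∧ (∀ i, 0 < e i 0) ∧ Function.Injective e ∧ (∀ i, (U i : Set E4) = p i ⁻¹' {y : E4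 | Kerr.rPlus (M i (y 0)) (a i (y 0)) - δ₀ < Kerr.radius (a i (y 0)) y}) ∧ (∀ i, S.IsLateChart (B i) Set.univ τ₀ (Ψ i) ∧ Ψ i '' ext i ⊆ O) ∧ (∀ i (R : ℝ), Tendsto (S.truncDeviationCk (B i) (Ψ i) 2 R) atTop (𝓝 0)) ∧ (∀ R : ℝ, ∃ τ₁, Pairwise (Disjoint on fun i ↦ Ψ i '' (B i).truncLateRegion τ₁ R)) ∧ (∀ i, Tendsto (fun t ↦ ρ i t / t) atTop (𝓝 0)) ∧ {x : E4 | τ₀ < x 0 ∧ ∀ i, ρ i (x 0) < E4.spatialNorm (p i x)} ⊆ ↑U₀ ∧ S.IsLateChart B₀ O τ₀ Ψ₀ ∧ Tendsto (S.deviationCk B₀ Ψ₀ 2) atTop (𝓝 0) ∧ O = exteriorOf 𝒞 (Ψ₀ '' B₀.lateRegion τ₀ ∪ ⋃ i, Ψ i '' ext i) ∧ (∀ τ₁ ≥ τ₀, RaysStayInClosure 𝒞 (exteriorOf 𝒞 (Ψ₀ '' B₀.lateRegion τ₁))) ∧ (∀ i (ϱ : ℝ), ∀ᶠ τ in atTop,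 ∀ x ∈ (B i).truncTimeSlab ϱ τ, 𝒟.timeOrientation.IsFutureDirected (mfderiv 𝓘(ℝ, E4) (𝓡 4) (Ψ i) x (L i (Kerr.timeVector (M i (p i x.1 0)) (a i (p i x.1 0)) (p i x.1))))) ∧ (∀ᶠ τ in atTop, ∀ x ∈ B₀.timeSlab τ, 𝒟.timeOrientation.IsFutureDirected (mfderiv 𝓘(ℝ, E4) (𝓡 4) Ψ₀ x (E4.basisVector 0))) ∧ O \ ((⋃ i, Ψ i '' (B i).lateRegion τ₀) ∪ Ψ₀ '' B₀.lateRegion τ₀) ⊆ J ((⋃ i, Ψ i '' (B i).timeSlab τ₀) ∪ Ψ₀ '' B₀.timeSlab τ₀) ∧ (∃ C₁ C₂ : ℝ, ∀ i (x : U i) (y : U₀), τ₀ < (B i).time x.1 → Ψ i x = Ψ₀ y → ‖E4.spatial y.1 - ξ i (y.1 0)‖ ≤ C₂ * (B i).radius x.1 + C₁) ∧ ∃ R : Fin N → ℝ → ℝ, (∀ i, Tendsto (fun τ ↦ S.truncDeviationCk (B i) (Ψ i) 2 (R i τ) τ) atTop (𝓝 0)) ∧ ∀ τ₁ > τ₀,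 O \ (Ψ₀ '' B₀.lateRegion τ₁ ∪ ⋃ i, Ψ i '' {x | τ₁ < (B i).time x.1 ∧ (B i).radius x.1 ≤ R i ((B i).time x.1)}) ⊆ J (Ψ₀ '' B₀.timeSlab τ₁ ∪ ⋃ i, Ψ i '' (B i).truncTimeSlab (R i τ₁) τ₁))) hF' h0' hinj' himm' hadm' hε hP
  -- (2) monotonicity: MGHD by MGHD, Stub 3 upgrades the `P₀`-era to the crux's `Q′`-era.
  refine key.mono ?_
  rintro D hD ⟨hex, hall⟩
  exact ⟨hex, fun 𝒟 h𝒟 ↦ ⟨(hall 𝒟 h𝒟).1, h₃ X D hD 𝒟 h𝒟 (hall 𝒟 h𝒟).1 (hall 𝒟 h𝒟).2⟩⟩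

/-! ### Consistency: each registered stub, stated EXPANDED, IS the named statement of §1. -/

theorem tameCensorship_holds : TameCensorship := stub_tameCensorship
theorem captureAlongCensoredCurves_holds : CaptureAlongCensoredCurves := stub_captureAlongCensoredCurves
theorem regularityDecayUpgrade_holds : RegularityDecayUpgrade := stub_regularityDecayUpgrade

/-- **The crux from the skeleton** (closed modulo the three `sorry`s). [folklore] -/
theorem ShapeSettledFinalEra_proof : Summit.FinalStateConjecture.FinalStateConjecture.Theses.RecedingSphereBudgets.ShapeSettledFinalEra :=
  ShapeSettledFinalEra_of stub_tameCensorship stub_captureAlongCensoredCurves stub_regularityDecayUpgrade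

/-! ### Sanity (no `sorry`): the crux implies Stub 1 (forget the era; `IsTameChristodoulouGeneric.mono`), so
Stub 1 is a genuine WEAKENING used toward the crux; Stubs 2–3 carry the settling content. -/

/-- The crux implies Stub 1. [folklore] -/
theorem tameCensorship_of_crux (h : Summit.FinalStateConjecture.FinalStateConjecture.Theses.RecedingSphereBudgets.ShapeSettledFinalEra) : TameCensorship := by
  intro X _ _ _ _ _ _
  refine (h X).mono ?_
  rintro D hD ⟨hex, hall⟩
  exact ⟨hex, fun 𝒟 h𝒟 ↦ (hall 𝒟 h𝒟).1⟩

end Summit.FinalStateConjecture.FinalStateConjecture.Cruxes.ShapeSettledFinalEra.Birth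

end
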